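import Summits.QuantumFields.YangMills.Theorems.PoincareLipschitzWenteOneCentreBound
import Summits.QuantumFields.YangMills.Theorems.PoincareLipschitzWenteOneCentreKernel
import Mathlib.MeasureTheory.Covering.DensityTheorem
import Mathlib.MeasureTheory.Measure.Lebesgue.EqHaar
import HarnessLib

/-!
# Crux `BlockLipschitzL` (stmt-QuantumFields-23533) ∕ `HistoryTailL` (stmt-QuantumFields-19936), LINE 25, stub S1″ — ROAD (W)
# «the H-system gap at 3π», brick W-ONE «WENTE ONE-CENTRE LEMMA», file 5: THE PRECISE REPRESENTATIVE

Cell `ym3-torus` (YM ladder rung R3 = continuum SU(2) Yang–Mills on T³ — a RUNG, NOT Clay: not d = 4, not infinite volume,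
not a mass gap); TWIN-WIDTH helper seat `ym-ust-19936-w7` g15; `--supports stmt-QuantumFields-19936`; THEOREMS ONLY (0 `def`,
0 `sorry`, default heartbeats); imports files 2–4 of W-ONE (annular identity, annular bound, kernel letters) and Mathlib's Lebesgue
differentiation theorem (`IsUnifLocDoublingMeasure.ae_tendsto_average_norm_sub`).

THE SETTING (one component of the H-system, ROAD (W) memo §2): `u a b : E² → ℝ` with weak gradients `Gu Ga Gb` on the plane,
`a b ‖Ga‖ ‖Gb‖ ∈ L²_loc`, `‖Ga‖ ‖Gb‖ ∈ L²(E²)`, and `−∫ Σ_k ∂_kη·Gu e_k = 2∫ η (Ga e₀ Gb e₁ − Ga e₁ Gb e₀)` for all test functions `η`.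
`𝒜_r u x = (π r²)⁻¹ ∫ Ψ(‖y − x‖²∕r²) u(y) dy` is the smooth annular average (`Ψ(t) = (4∕3)·ST′((4t−1)∕3)`).

WHAT THIS FILE PROVES:
* ★★ `abs_annularAverage_sub_le_of_subset` — `|𝒜_{r₀} u x − 𝒜_{r₁} u x| ≤ π⁻¹ √(∫_S ‖Ga‖²) √(∫_S ‖Gb‖²)` for `0 < r₀ ≤ r₁` and any
  measurable `S ⊇ {r₀∕2 < ‖y − x‖ < r₁}` (files 2 + 3);
* ★ `exists_ball_setIntegral_lt`, `exists_tail_setIntegral_lt` — small balls and far tails carry little of an integrable density;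
* ★★★ `exists_pointValue` — THE PRECISE REPRESENTATIVE: there is `ū : E² → ℝ` with `𝒜_{1∕R} u x → ū x` (`R → ∞`) for EVERY `x`,
  `|ū x − 𝒜_r u x| ≤ π⁻¹ √(∫_{B_r(x)} ‖Ga‖²) √(∫_{B_r(x)} ‖Gb‖²)` for every `r > 0`, and `ū = u` a.e. (Lebesgue points).
HONEST SCOPE.  One component under hypothesis rows; nothing of (W-OSC), (GAP), (TM), S1″, K1, `MeanDeviationL`, `BlockLipschitzL`,
`HistoryTailL` is proved here.  YM₃ on T³ is rung R3, not Clay; YM gap NOT proved; no summit statement is proved here.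

References: H. Wente (1969); [BrezisCoron1985] Lemma A.1; [Helein2002] §3.1; [Topping1997].
-/

set_option autoImplicit false

noncomputable section

open MeasureTheory Set Function Filter Topology Metric TopologicalSpace
open scoped ContDiff BigOperators RealInnerProductSpace

namespace Summit.QuantumFields.YangMills.Theorems.PoincareLipschitzWenteOneCentreAverages

open Literature.Analysis.FunctionSpaces (HasWeakFDerivOn)
open Literature.Analysis.FluidPDE (perp)
open Summit.QuantumFields.YangMills.Theorems.PoincareLipschitzWenteOneCentreIdentity (annularAverage_sub_eq diffProfile_props)
open Summit.QuantumFields.YangMills.Theorems.PoincareLipschitzWenteOneCentreBound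
  (abs_integral_radialWeight_mul_weakGrad_perp_le opNorm_sq_eq_sum_sq)
open Summit.QuantumFields.YangMills.Theorems.PoincareLipschitzWenteOneCentreKernel
  (exists_annularKernel_bound abs_annularAverage_sub_le_average)

/-! ## §1 Letters on integrable densities -/

/-- `∫_S ‖G‖² = ∫_S Σ_k (G e_k)²`. [folklore] -/
theorem setIntegral_normSq_eq (G : EuclideanSpace ℝ (Fin 2) → EuclideanSpace ℝ (Fin 2) →L[ℝ] ℝ) (S : Set (EuclideanSpace ℝ (Fin 2))) :
    ∫ y in S, ‖G y‖ ^ 2 = ∫ y in S, ∑ k : Fin 2, (G y (EuclideanSpace.single k (1:ℝ))) ^ 2 :=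
  integral_congr_ae (Filter.Eventually.of_forall fun y => opNorm_sq_eq_sum_sq (G y))

/-- Small balls carry little of an integrable nonnegative density. [folklore] -/
theorem exists_ball_setIntegral_lt {f : EuclideanSpace ℝ (Fin 2) → ℝ} (hf : Integrable f volume)
    (x : EuclideanSpace ℝ (Fin 2)) {ε : ℝ} (hε : 0 < ε) : ∃ r : ℝ, 0 < r ∧ ∫ y in ball x r, f y < ε := by
  set s : ℕ → Set (EuclideanSpace ℝ (Fin 2)) := fun n => ball x (1 / ((n:ℝ) + 1)) with hs
  have hanti : Antitone s := by
    intro m n hmn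
    apply ball_subset_ball
    have : (m:ℝ) + 1 ≤ (n:ℝ) + 1 := by exact_mod_cast Nat.succ_le_succ hmn
    exact one_div_le_one_div_of_le (by positivity) this
  have hlim := tendsto_setIntegral_of_antitone (μ := volume) (f := f) (fun n => measurableSet_ball) hanti ⟨0, hf.integrableOn⟩
  have hI : (⋂ n, s n) ⊆ {x} := by
    intro y hy
    rw [mem_iInter] at hy
    rw [mem_singleton_iff]
    by_contra hne
    have hd : 0 < dist y x := dist_pos.2 hne
    obtain ⟨n, hn⟩ := exists_nat_gt (1 / dist y x)
    have hy' := hy n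
    rw [hs, mem_ball] at hy'
    have h1 : 1 / ((n:ℝ) + 1) < dist y x := by
      rw [div_lt_iff₀ (by positivity)]
      rw [div_lt_iff₀ hd] at hn
      nlinarith
    linarith
  have hzero : ∫ y in ⋂ n, s n, f y = 0 :=
    setIntegral_measure_zero _ (measure_mono_null hI (measure_singleton x))
  rw [hzero] at hlim
  obtain ⟨n, hn⟩ := (hlim.eventually (gt_mem_nhds hε)).exists
  exact ⟨1 / ((n:ℝ) + 1), by positivity, hn⟩

/-- Far tails carry little of an integrable nonnegative density. [folklore] -/
theorem exists_tail_setIntegral_lt {f : EuclideanSpace ℝ (Fin 2) → ℝ} (hf : Integrable f volume)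
    (x : EuclideanSpace ℝ (Fin 2)) {ε : ℝ} (hε : 0 < ε) : ∃ n : ℕ, ∫ y in (closedBall x n)ᶜ, f y < ε := by
  set s : ℕ → Set (EuclideanSpace ℝ (Fin 2)) := fun n => (closedBall x n)ᶜ with hs
  have hanti : Antitone s := fun m n hmn => compl_subset_compl.2 (closedBall_subset_closedBall (by exact_mod_cast hmn))
  have hlim := tendsto_setIntegral_of_antitone (μ := volume) (f := f) (fun n => measurableSet_closedBall.compl) hanti
    ⟨0, hf.integrableOn⟩
  have hI : (⋂ n, s n) = ∅ := by
    ext y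
    simp only [mem_iInter, mem_empty_iff_false, iff_false, not_forall]
    obtain ⟨n, hn⟩ := exists_nat_ge (dist y x)
    exact ⟨n, fun h => h (mem_closedBall.2 hn)⟩
  rw [hI, Measure.restrict_empty, integral_zero_measure] at hlim
  obtain ⟨n, hn⟩ := (hlim.eventually (gt_mem_nhds hε)).exists
  exact ⟨n, hn⟩

/-! ## §2 The annular averages of two radii -/

section Data

variable {u a b : EuclideanSpace ℝ (Fin 2) → ℝ} {Gu Ga Gb : EuclideanSpace ℝ (Fin 2) → EuclideanSpace ℝ (Fin 2) →L[ℝ] ℝ}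

/-- ★★ **Two radii, any superset.**  For `0 < r₀ ≤ r₁` and a measurable `S ⊇ {r₀∕2 < ‖y − x‖ < r₁}` on which `‖Ga‖², ‖Gb‖²` are integrable,
`|𝒜_{r₀} u x − 𝒜_{r₁} u x| ≤ π⁻¹ √(∫_S ‖Ga‖²) √(∫_S ‖Gb‖²)`. [cite: Helein2002, §3.1 (Wente's lemma); Topping1997, Theorem 1] -/
theorem abs_annularAverage_sub_le_of_subset
    (hu : HasWeakFDerivOn (⟨univ, isOpen_univ⟩ : Opens (EuclideanSpace ℝ (Fin 2))) volume u Gu)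
    (ha : HasWeakFDerivOn (⟨univ, isOpen_univ⟩ : Opens (EuclideanSpace ℝ (Fin 2))) volume a Ga)
    (hb : HasWeakFDerivOn (⟨univ, isOpen_univ⟩ : Opens (EuclideanSpace ℝ (Fin 2))) volume b Gb)
    (ha2 : LocallyIntegrable (fun y => a y ^ 2) volume) (hb2 : LocallyIntegrable (fun y => b y ^ 2) volume)
    (hGa2 : LocallyIntegrable (fun y => ‖Ga y‖ ^ 2) volume) (hGb2 : LocallyIntegrable (fun y => ‖Gb y‖ ^ 2) volume)
    (hEq : ∀ η : EuclideanSpace ℝ (Fin 2) → ℝ, ContDiff ℝ ∞ η → HasCompactSupport η →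
      -(∫ y, ∑ k : Fin 2, fderiv ℝ η y (EuclideanSpace.single k (1:ℝ)) * Gu y (EuclideanSpace.single k (1:ℝ))) =
        2 * ∫ y, η y * (Ga y (EuclideanSpace.single 0 (1:ℝ)) * Gb y (EuclideanSpace.single 1 (1:ℝ)) -
          Ga y (EuclideanSpace.single 1 (1:ℝ)) * Gb y (EuclideanSpace.single 0 (1:ℝ))))
    (x : EuclideanSpace ℝ (Fin 2)) {r₀ r₁ : ℝ} (hr₀ : 0 < r₀) (hle : r₀ ≤ r₁)
    {S : Set (EuclideanSpace ℝ (Fin 2))} (hS : {y | r₀ / 2 < ‖y - x‖ ∧ ‖y - x‖ < r₁} ⊆ S)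
    (hGaS : IntegrableOn (fun y => ‖Ga y‖ ^ 2) S volume) (hGbS : IntegrableOn (fun y => ‖Gb y‖ ^ 2) S volume) :
    |(Real.pi * r₀ ^ 2)⁻¹ * (∫ y, (4/3 : ℝ) * deriv Real.smoothTransition ((4 * (‖y - x‖ ^ 2 / r₀ ^ 2) - 1) / 3) * u y) -
      (Real.pi * r₁ ^ 2)⁻¹ * (∫ y, (4/3 : ℝ) * deriv Real.smoothTransition ((4 * (‖y - x‖ ^ 2 / r₁ ^ 2) - 1) / 3) * u y)| ≤
      (Real.pi)⁻¹ * Real.sqrt (∫ y in S, ‖Ga y‖ ^ 2) * Real.sqrt (∫ y in S, ‖Gb y‖ ^ 2) := by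
  have hr₁ : 0 < r₁ := hr₀.trans_le hle
  rw [annularAverage_sub_eq x hu ha hb ha2 hb2 hGa2 hGb2 hEq hr₀ hr₁]
  obtain ⟨hgs, hgS, -, hg1, hg0⟩ := diffProfile_props hr₀ hr₁
  have hmin : min (r₀ ^ 2) (r₁ ^ 2) = r₀ ^ 2 := min_eq_left (pow_le_pow_left₀ hr₀.le hle 2)
  have hmax : max (r₀ ^ 2) (r₁ ^ 2) = r₁ ^ 2 := max_eq_right (pow_le_pow_left₀ hr₀.le hle 2)
  have hκ0 : ∀ s : ℝ, (s ≤ (r₀ / 2) ^ 2 ∨ r₁ ^ 2 ≤ s) →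
      (Real.smoothTransition ((4 * s / r₀ ^ 2 - 1) / 3) - Real.smoothTransition ((4 * s / r₁ ^ 2 - 1) / 3)) / s = 0 := by
    intro s hs
    rcases hs with hs | hs
    · exact hg0 s (by rw [hmin]; nlinarith)
    · exact hgS s (by rw [hmax]; exact hs)
  have hB := abs_integral_radialWeight_mul_weakGrad_perp_le x ha hb ha2 hb2 hGa2 hGb2 hgs.continuous hg1
    (half_pos hr₀) (show r₀ / 2 ≤ r₁ by linarith) hκ0
  have hmono : ∀ {G : EuclideanSpace ℝ (Fin 2) → EuclideanSpace ℝ (Fin 2) →L[ℝ] ℝ}, IntegrableOn (fun y => ‖G y‖ ^ 2) S volume →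
      Real.sqrt (∫ y in {y | r₀ / 2 < ‖y - x‖ ∧ ‖y - x‖ < r₁}, ‖G y‖ ^ 2) ≤ Real.sqrt (∫ y in S, ‖G y‖ ^ 2) := by
    intro G hG
    exact Real.sqrt_le_sqrt (setIntegral_mono_set hG (Filter.Eventually.of_forall fun y => sq_nonneg _)
      (Filter.Eventually.of_forall hS))
  rw [abs_mul, abs_neg, abs_inv, abs_of_pos Real.pi_pos, mul_assoc]
  refine mul_le_mul_of_nonneg_left (hB.trans ?_) (by positivity)
  exact mul_le_mul (hmono hGaS) (hmono hGbS) (Real.sqrt_nonneg _) (Real.sqrt_nonneg _)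

/-! ## §3 The precise representative -/

/-- ★★★ **THE PRECISE REPRESENTATIVE.**  Under the rows (with `‖Ga‖², ‖Gb‖²` integrable on the plane) there is `ū : E² → ℝ` with:
`𝒜_{1∕R} u x → ū x` as `R → ∞` for EVERY `x`; `|ū x − 𝒜_r u x| ≤ π⁻¹ √(∫_{B_r(x)} ‖Ga‖²) √(∫_{B_r(x)} ‖Gb‖²)` for every `r > 0`;
and `ū = u` almost everywhere (at every Lebesgue point of `u`). [cite: Helein2002, §3.1; Topping1997, Theorem 1] -/
theorem exists_pointValue
    (hu : HasWeakFDerivOn (⟨univ, isOpen_univ⟩ : Opens (EuclideanSpace ℝ (Fin 2))) volume u Gu)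
    (ha : HasWeakFDerivOn (⟨univ, isOpen_univ⟩ : Opens (EuclideanSpace ℝ (Fin 2))) volume a Ga)
    (hb : HasWeakFDerivOn (⟨univ, isOpen_univ⟩ : Opens (EuclideanSpace ℝ (Fin 2))) volume b Gb)
    (ha2 : LocallyIntegrable (fun y => a y ^ 2) volume) (hb2 : LocallyIntegrable (fun y => b y ^ 2) volume)
    (hGa : Integrable (fun y => ‖Ga y‖ ^ 2) volume) (hGb : Integrable (fun y => ‖Gb y‖ ^ 2) volume)
    (hEq : ∀ η : EuclideanSpace ℝ (Fin 2) → ℝ, ContDiff ℝ ∞ η → HasCompactSupport η →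
      -(∫ y, ∑ k : Fin 2, fderiv ℝ η y (EuclideanSpace.single k (1:ℝ)) * Gu y (EuclideanSpace.single k (1:ℝ))) =
        2 * ∫ y, η y * (Ga y (EuclideanSpace.single 0 (1:ℝ)) * Gb y (EuclideanSpace.single 1 (1:ℝ)) -
          Ga y (EuclideanSpace.single 1 (1:ℝ)) * Gb y (EuclideanSpace.single 0 (1:ℝ)))) :
    ∃ ū : EuclideanSpace ℝ (Fin 2) → ℝ,
      (∀ x, Tendsto (fun R : ℝ => (Real.pi * (R⁻¹) ^ 2)⁻¹ *
        ∫ y, (4/3 : ℝ) * deriv Real.smoothTransition ((4 * (‖y - x‖ ^ 2 / (R⁻¹) ^ 2) - 1) / 3) * u y) atTop (𝓝 (ū x))) ∧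
      (∀ x (r : ℝ), 0 < r → |ū x - (Real.pi * r ^ 2)⁻¹ *
        ∫ y, (4/3 : ℝ) * deriv Real.smoothTransition ((4 * (‖y - x‖ ^ 2 / r ^ 2) - 1) / 3) * u y| ≤
        (Real.pi)⁻¹ * Real.sqrt (∫ y in ball x r, ‖Ga y‖ ^ 2) * Real.sqrt (∫ y in ball x r, ‖Gb y‖ ^ 2)) ∧
      ū =ᵐ[volume] u := by
  have hGa2 : LocallyIntegrable (fun y => ‖Ga y‖ ^ 2) volume := hGa.locallyIntegrable
  have hGb2 : LocallyIntegrable (fun y => ‖Gb y‖ ^ 2) volume := hGb.locallyIntegrable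
  -- the two-radii bound on a ball
  have hball : ∀ x (r₀ r₁ r : ℝ), 0 < r₀ → r₀ ≤ r₁ → r₁ ≤ r →
      |(Real.pi * r₀ ^ 2)⁻¹ * (∫ y, (4/3 : ℝ) * deriv Real.smoothTransition ((4 * (‖y - x‖ ^ 2 / r₀ ^ 2) - 1) / 3) * u y) -
        (Real.pi * r₁ ^ 2)⁻¹ * (∫ y, (4/3 : ℝ) * deriv Real.smoothTransition ((4 * (‖y - x‖ ^ 2 / r₁ ^ 2) - 1) / 3) * u y)| ≤
        (Real.pi)⁻¹ * Real.sqrt (∫ y in ball x r, ‖Ga y‖ ^ 2) * Real.sqrt (∫ y in ball x r, ‖Gb y‖ ^ 2) := by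
    intro x r₀ r₁ r hr₀ hle hr
    refine abs_annularAverage_sub_le_of_subset hu ha hb ha2 hb2 hGa2 hGb2 hEq x hr₀ hle (fun y hy => ?_)
      hGa.integrableOn hGb.integrableOn
    rw [mem_ball, dist_eq_norm]; exact hy.2.trans_le hr
  -- smallness of small-ball energies
  have hsmall : ∀ x (ε : ℝ), 0 < ε → ∃ r : ℝ, 0 < r ∧
      (Real.pi)⁻¹ * Real.sqrt (∫ y in ball x r, ‖Ga y‖ ^ 2) * Real.sqrt (∫ y in ball x r, ‖Gb y‖ ^ 2) < ε := by
    intro x ε hε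
    have hπε : 0 < Real.pi * ε := mul_pos Real.pi_pos hε
    obtain ⟨ra, hra, hA⟩ := exists_ball_setIntegral_lt hGa x hπε
    obtain ⟨rb, hrb, hB⟩ := exists_ball_setIntegral_lt hGb x hπε
    refine ⟨min ra rb, lt_min hra hrb, ?_⟩
    have hA' : ∫ y in ball x (min ra rb), ‖Ga y‖ ^ 2 < Real.pi * ε :=
      (setIntegral_mono_set hGa.integrableOn (Filter.Eventually.of_forall fun y => sq_nonneg _)
        (Filter.Eventually.of_forall (ball_subset_ball (min_le_left _ _)))).trans_lt hA
    have hB' : ∫ y in ball x (min ra rb), ‖Gb y‖ ^ 2 < Real.pi * ε :=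
      (setIntegral_mono_set hGb.integrableOn (Filter.Eventually.of_forall fun y => sq_nonneg _)
        (Filter.Eventually.of_forall (ball_subset_ball (min_le_right _ _)))).trans_lt hB
    have h1 : Real.sqrt (∫ y in ball x (min ra rb), ‖Ga y‖ ^ 2) < Real.sqrt (Real.pi * ε) :=
      Real.sqrt_lt_sqrt (setIntegral_nonneg measurableSet_ball fun y _ => sq_nonneg _) hA'
    have h2 : Real.sqrt (∫ y in ball x (min ra rb), ‖Gb y‖ ^ 2) < Real.sqrt (Real.pi * ε) :=
      Real.sqrt_lt_sqrt (setIntegral_nonneg measurableSet_ball fun y _ => sq_nonneg _) hB'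
    have h3 : Real.sqrt (∫ y in ball x (min ra rb), ‖Ga y‖ ^ 2) * Real.sqrt (∫ y in ball x (min ra rb), ‖Gb y‖ ^ 2) <
        Real.sqrt (Real.pi * ε) * Real.sqrt (Real.pi * ε) :=
      mul_lt_mul'' h1 h2 (Real.sqrt_nonneg _) (Real.sqrt_nonneg _)
    rw [Real.mul_self_sqrt hπε.le] at h3
    rw [mul_assoc]
    calc (Real.pi)⁻¹ * (Real.sqrt (∫ y in ball x (min ra rb), ‖Ga y‖ ^ 2) * Real.sqrt (∫ y in ball x (min ra rb), ‖Gb y‖ ^ 2))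
        < (Real.pi)⁻¹ * (Real.pi * ε) := mul_lt_mul_of_pos_left h3 (inv_pos.2 Real.pi_pos)
      _ = ε := by field_simp
  -- Cauchy at `0⁺` along `R ↦ 1/R`
  have hCauchy : ∀ x, CauchySeq fun R : ℝ => (Real.pi * (R⁻¹) ^ 2)⁻¹ *
      ∫ y, (4/3 : ℝ) * deriv Real.smoothTransition ((4 * (‖y - x‖ ^ 2 / (R⁻¹) ^ 2) - 1) / 3) * u y := by
    intro x
    rw [Metric.cauchySeq_iff]
    intro ε hε
    obtain ⟨r, hr, hrε⟩ := hsmall x ε hε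
    refine ⟨r⁻¹, fun m hm n hn => ?_⟩
    have hm0 : 0 < m := (inv_pos.2 hr).trans_le hm
    have hn0 : 0 < n := (inv_pos.2 hr).trans_le hn
    have hmr : m⁻¹ ≤ r := by rw [inv_le_comm₀ hm0 hr]; exact hm
    have hnr : n⁻¹ ≤ r := by rw [inv_le_comm₀ hn0 hr]; exact hn
    rw [Real.dist_eq]
    rcases le_total m n with hmn | hnm
    · have hle : n⁻¹ ≤ m⁻¹ := inv_anti₀ hm0 hmn
      rw [abs_sub_comm]
      exact (hball x n⁻¹ m⁻¹ r (inv_pos.2 hn0) hle hmr).trans_lt hrε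
    · have hle : m⁻¹ ≤ n⁻¹ := inv_anti₀ hn0 hnm
      exact (hball x m⁻¹ n⁻¹ r (inv_pos.2 hm0) hle hnr).trans_lt hrε
  choose ū hū using fun x => cauchySeq_tendsto_of_complete (hCauchy x)
  -- the ball bound for `ū`
  have hūball : ∀ x (r : ℝ), 0 < r → |ū x - (Real.pi * r ^ 2)⁻¹ *
      ∫ y, (4/3 : ℝ) * deriv Real.smoothTransition ((4 * (‖y - x‖ ^ 2 / r ^ 2) - 1) / 3) * u y| ≤
      (Real.pi)⁻¹ * Real.sqrt (∫ y in ball x r, ‖Ga y‖ ^ 2) * Real.sqrt (∫ y in ball x r, ‖Gb y‖ ^ 2) := by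
    intro x r hr
    have hlim := ((hū x).sub_const ((Real.pi * r ^ 2)⁻¹ *
      ∫ y, (4/3 : ℝ) * deriv Real.smoothTransition ((4 * (‖y - x‖ ^ 2 / r ^ 2) - 1) / 3) * u y)).abs
    refine le_of_tendsto hlim ?_
    filter_upwards [Filter.eventually_ge_atTop r⁻¹, Filter.eventually_gt_atTop (0:ℝ)] with R hR hR0
    have hRr : R⁻¹ ≤ r := by rw [inv_le_comm₀ hR0 hr]; exact hR
    exact hball x R⁻¹ r r (inv_pos.2 hR0) hRr le_rfl
  refine ⟨ū, hū, hūball, ?_⟩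
  -- `ū = u` at every Lebesgue point
  have hul : LocallyIntegrable u volume := by
    have := hu.locallyIntegrableOn; simpa [locallyIntegrableOn_univ] using this
  obtain ⟨M, hM0, hM⟩ := exists_annularKernel_bound
  have hLeb := IsUnifLocDoublingMeasure.ae_tendsto_average_norm_sub (μ := volume) hul 1
  filter_upwards [hLeb] with x hx
  have hx' := hx (fun _ : ℝ => x) (fun R : ℝ => R⁻¹) tendsto_inv_atTop_nhdsGT_zero (by
    filter_upwards [Filter.eventually_gt_atTop (0:ℝ)] with R hR
    rw [mem_closedBall, dist_self, one_mul]; positivity)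
  -- `𝒜_{1/R} u x → u x`
  have hg : Tendsto (fun R : ℝ => (M * volume.real (ball (0 : EuclideanSpace ℝ (Fin 2)) 1) / Real.pi) *
      ⨍ y in closedBall x R⁻¹, ‖u y - u x‖) atTop (𝓝 0) := by
    simpa using hx'.const_mul (M * volume.real (ball (0 : EuclideanSpace ℝ (Fin 2)) 1) / Real.pi)
  have hto : Tendsto (fun R : ℝ => (Real.pi * (R⁻¹) ^ 2)⁻¹ *
      ∫ y, (4/3 : ℝ) * deriv Real.smoothTransition ((4 * (‖y - x‖ ^ 2 / (R⁻¹) ^ 2) - 1) / 3) * u y) atTop (𝓝 (u x)) := by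
    rw [tendsto_iff_norm_sub_tendsto_zero]
    refine squeeze_zero_norm' ?_ hg
    filter_upwards [Filter.eventually_gt_atTop (0:ℝ)] with R hR
    simp only [Real.norm_eq_abs, abs_abs]
    exact abs_annularAverage_sub_le_average hul hM x (inv_pos.2 hR)
  exact tendsto_nhds_unique (hū x) hto

end Data

end Summit.QuantumFields.YangMills.Theorems.PoincareLipschitzWenteOneCentreAverages

end
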